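import Summits.AtomisticToContinuum.BoseEinsteinCondensation.Theorems.BECThomsonPrincipleGDTransferSeededDefs
import Summits.AtomisticToContinuum.BoseEinsteinCondensation.Theorems.BECThomsonPrincipleGDTransferLnssAlgebraAdjoint
import Summits.AtomisticToContinuum.BoseEinsteinCondensation.Theorems.BECConjugateDominationNearMinimiserStabilityHelpers

/-!
# Route `BECThomsonPrinciple`, crux `GDTransfer` (stmt-AtomisticToContinuum-9482), line `seeded-continuity`:
# stub `stub_countLaw` — the `n̂₀`-law of a state through the crux's `Q_S` is a probability law with mean `⟨n̂₀⟩`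

Registered stub `stub_countLaw : Sig.stub_countLaw` (`= CountLaw` of
`Theorems/BECThomsonPrincipleGDTransferSeededDefs.lean`).  With `w_S(ψ) = compMass m L S ψ = ∫_{cell^N} |Q_S ψ|²`
(`Q_S = Negative.modeProj`, the crux's `foldr` of the commuting cell averages `P_i = Negative.cellAvg`):

1. for a periodic trial state `Σ_S w_S(Ψ) = 1` — the `Q_S` resolve the identity orthogonally on continuous
   functions (`Lnss.sum_integral_norm_sq_modeProj`, moved to `ℝ≥0∞` in `sum_compMass_eq_lintegral`) and `‖Ψ‖ = 1`;
   and `Σ_S |S| w_S(Ψ) = ⟨Ψ, n̂₀Ψ⟩ = condensateOccupation`: `|S| = Σ_i [i ∈ S]`, `Q_S P_i = [i ∈ S] Q_S`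
   (`modeProj_cellAvg`, from `Lnss.cellAvg_foldr_comm` / `Lnss.cellAvg_modeProj`), so that
   `Σ_{S ∋ i} w_S(ψ) = Σ_S w_S(P_i ψ) = ∫ |P_i ψ|²`, and `Σ_i ∫_{cell^N} |P_i Ψ|² = ⟨Ψ, n̂₀Ψ⟩` is Fournais's
   `n₀ = Σ_j P_{Ω,j}` (`sum_lintegral_sliceMeanSq`, Bose symmetry inside);
2. the `L²`-Lipschitz bound of partial sums of the law: for continuous `f, g` with `∫|g|² ≤ 1`, `∫|f-g|² ≤ η²`,
   `Σ_{S∈T} w_S(f) ≤ Σ_{S∈T} w_S(g) + 2η + η²` — Peter–Paul `|a+b|² ≤ (1+η)|a|² + (1+η⁻¹)|b|²` pointwise on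
   `Q_S f = Q_S g + Q_S(f-g)` (`Theorems.coe_nnnorm_add_sq_le`), then `Σ_S w_S(g) = ∫|g|² ≤ 1` and
   `Σ_S w_S(f-g) = ∫|f-g|² ≤ η²` (template: `Theorems.condensateOccupation_le_of_sub_le`).

All [folklore] (LSSY2005 App. A; Fournais2020 (1.3)–(1.5)).
-/

noncomputable section

open MeasureTheory Filter
open scoped ENNReal NNReal

namespace Summit.AtomisticToContinuum.BoseEinsteinCondensation.Cruxes.GDTransfer.Seeded

open Literature.MathematicalPhysics.QuantumManyBody.BoseGas
open Summit.AtomisticToContinuum.BoseEinsteinCondensation.Theorems.GaussianDominationCan.Negative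
  (modeProj cellAvg continuous_cellAvg)
open Summit.AtomisticToContinuum.BoseEinsteinCondensation.Cruxes.GDTransfer.DysonDressedWitness.ChordVariation
  (continuous_modeProj modeProj_add)
open Summit.AtomisticToContinuum.BoseEinsteinCondensation.Cruxes.GDTransfer.DysonDressedWitness.Lnss
  (lintegral_nnnorm_sq_eq sum_integral_norm_sq_modeProj cellAvg_modeProj cellAvg_foldr_comm)

variable {m : ℕ} {L : ℝ}

/-! ## (1) Resolution of the identity in `ℝ≥0∞`; the mean of the law -/

/-- **`Σ_S w_S(g) = ∫_{cell^N} |g|²`** in `ℝ≥0∞` for continuous `g` (orthogonal resolution of the identity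
`Σ_S Q_S = 1`, `Lnss.sum_integral_norm_sq_modeProj`). [folklore] -/
theorem sum_compMass_eq_lintegral (hL : 0 < L) {g : Config (m + 1) → ℂ} (hg : Continuous g) :
    ∑ S : Finset (Fin (m + 1)), compMass m L S g =
      ∫⁻ X in cellN (m + 1) L, (‖g X‖₊ : ℝ≥0∞) ^ 2 := by
  unfold compMass
  have h : ∀ S : Finset (Fin (m + 1)),
      ∫⁻ X in cellN (m + 1) L, (‖modeProj (m + 1) L S g X‖₊ : ℝ≥0∞) ^ 2 =
        ENNReal.ofReal (∫ X in cellN (m + 1) L, ‖modeProj (m + 1) L S g X‖ ^ 2) := fun S =>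
    lintegral_nnnorm_sq_eq _ (continuous_modeProj S hg)
  simp only [h]
  rw [← ENNReal.ofReal_sum_of_nonneg (fun S _ => integral_nonneg fun X => sq_nonneg _),
    sum_integral_norm_sq_modeProj hL hg, lintegral_nnnorm_sq_eq g hg]

/-- **(1a)** The component masses of a periodic trial state sum to `1`. [folklore] -/
theorem sum_compMass_trialState (hL : 0 < L) (Ψ : PeriodicTrialState (m + 1) L) :
    ∑ S : Finset (Fin (m + 1)), compMass m L S Ψ.ψ = 1 := by
  rw [sum_compMass_eq_lintegral hL Ψ.contDiff.continuous, Ψ.norm_eq]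

/-- **`Q_S P_i = [i ∈ S] Q_S`** on continuous functions (`P_i` commutes with the `foldr` and
`P_i Q_S = [i ∈ S] Q_S`). [folklore] -/
theorem modeProj_cellAvg {N : ℕ} (hL : 0 < L) (S : Finset (Fin N)) (i : Fin N) {g : Config N → ℂ}
    (hg : Continuous g) :
    modeProj N L S (cellAvg N L i g) = if i ∈ S then modeProj N L S g else 0 := by
  rw [← cellAvg_modeProj hL S i hg]
  unfold modeProj
  exact (cellAvg_foldr_comm S _ i hg).symm

/-- `w_S(P_i g) = [i ∈ S] w_S(g)` for continuous `g`. [folklore] -/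
theorem compMass_cellAvg (hL : 0 < L) (S : Finset (Fin (m + 1))) (i : Fin (m + 1))
    {g : Config (m + 1) → ℂ} (hg : Continuous g) :
    compMass m L S (cellAvg (m + 1) L i g) = if i ∈ S then compMass m L S g else 0 := by
  unfold compMass
  rw [modeProj_cellAvg hL S i hg]
  split_ifs
  · rfl
  · simp

/-- `‖P_i g(X)‖₊² = L⁻³ · (L⁻³ |∫_cell g(X; xᵢ = x) dx|²)` in `ℝ≥0∞` (`L > 0`). [folklore] -/
theorem coe_nnnorm_cellAvg_sq {N : ℕ} (hL : 0 < L) (i : Fin N) (g : Config N → ℂ) (X : Config N) :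
    (‖cellAvg N L i g X‖₊ : ℝ≥0∞) ^ 2 =
      (ENNReal.ofReal L ^ 3)⁻¹ * ((ENNReal.ofReal L ^ 3)⁻¹ *
        (‖∫ x in cell L, g (Function.update X i x)‖₊ : ℝ≥0∞) ^ 2) := by
  have hL3 : 0 < L ^ 3 := by positivity
  have hc : ((‖((L ^ 3)⁻¹ : ℝ)‖₊ : ℝ≥0∞)) = (ENNReal.ofReal L ^ 3)⁻¹ := by
    rw [← ENNReal.ofReal_pow hL.le, ← ENNReal.ofReal_inv_of_pos hL3, ← enorm_eq_nnnorm,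
      ← ofReal_norm, Real.norm_of_nonneg (inv_nonneg.2 hL3.le)]
  show (‖((L ^ 3)⁻¹ : ℝ) • ∫ x in cell L, g (Function.update X i x)‖₊ : ℝ≥0∞) ^ 2 = _
  rw [nnnorm_smul, ENNReal.coe_mul, mul_pow, hc]
  ring

/-- **(1b)** The mean of the law is the condensate occupation: `Σ_S |S| w_S(Ψ) = ⟨Ψ, n̂₀Ψ⟩`.
[folklore] -/
theorem sum_card_mul_compMass_trialState (hL : 0 < L) (Ψ : PeriodicTrialState (m + 1) L) :
    ∑ S : Finset (Fin (m + 1)), (S.card : ℝ≥0∞) * compMass m L S Ψ.ψ =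
      condensateOccupation (m + 1) L Ψ.ψ := by
  have hψ : Continuous Ψ.ψ := Ψ.contDiff.continuous
  calc ∑ S : Finset (Fin (m + 1)), (S.card : ℝ≥0∞) * compMass m L S Ψ.ψ
      = ∑ S : Finset (Fin (m + 1)), ∑ i : Fin (m + 1),
          (if i ∈ S then compMass m L S Ψ.ψ else 0) := by
        refine Finset.sum_congr rfl fun S _ => ?_
        rw [Finset.sum_ite_mem Finset.univ S, Finset.univ_inter, Finset.sum_const, nsmul_eq_mul]
    _ = ∑ i : Fin (m + 1), ∑ S : Finset (Fin (m + 1)),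
          compMass m L S (cellAvg (m + 1) L i Ψ.ψ) := by
        rw [Finset.sum_comm]
        refine Finset.sum_congr rfl fun i _ => Finset.sum_congr rfl fun S _ => ?_
        rw [compMass_cellAvg hL S i hψ]
    _ = ∑ i : Fin (m + 1), ∫⁻ X in cellN (m + 1) L, (‖cellAvg (m + 1) L i Ψ.ψ X‖₊ : ℝ≥0∞) ^ 2 :=
        Finset.sum_congr rfl fun i _ => sum_compMass_eq_lintegral hL (continuous_cellAvg i hψ)
    _ = ∑ i : Fin (m + 1), (ENNReal.ofReal L ^ 3)⁻¹ *
          ∫⁻ X in cellN (m + 1) L, (ENNReal.ofReal L ^ 3)⁻¹ *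
            (‖∫ x in cell L, Ψ.ψ (Function.update X i x)‖₊ : ℝ≥0∞) ^ 2 := by
        refine Finset.sum_congr rfl fun i _ => ?_
        simp only [coe_nnnorm_cellAvg_sq hL]
        rw [lintegral_const_mul _ ((measurable_sliceMeanSq L i hψ).const_mul _)]
    _ = condensateOccupation (m + 1) L Ψ.ψ := sum_lintegral_sliceMeanSq hL Ψ

/-! ## (2) The law is `L²`-Lipschitz -/

/-- **(2)** For continuous `f, g` with `∫_{cell^N}|g|² ≤ 1` and `∫_{cell^N}|f - g|² ≤ η²` (`η > 0`), every
partial sum of component masses satisfies `Σ_{S∈T} w_S(f) ≤ Σ_{S∈T} w_S(g) + 2η + η²`. [folklore] -/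
theorem sum_compMass_le_of_sub_le (hL : 0 < L) (T : Finset (Finset (Fin (m + 1))))
    {f g : Config (m + 1) → ℂ} (hf : Continuous f) (hg : Continuous g)
    (hg1 : ∫⁻ X in cellN (m + 1) L, (‖g X‖₊ : ℝ≥0∞) ^ 2 ≤ 1) {η : ℝ} (hη : 0 < η)
    (hfg : ∫⁻ X in cellN (m + 1) L, (‖f X - g X‖₊ : ℝ≥0∞) ^ 2 ≤ ENNReal.ofReal (η ^ 2)) :
    ∑ S ∈ T, compMass m L S f ≤ ∑ S ∈ T, compMass m L S g + ENNReal.ofReal (2 * η + η ^ 2) := by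
  set h : Config (m + 1) → ℂ := f - g with hh
  have hhc : Continuous h := hf.sub hg
  have hfgh : f = g + h := by rw [hh, add_sub_cancel]
  -- pointwise Peter–Paul on `Q_S f = Q_S g + Q_S h`, integrated
  have hS : ∀ S : Finset (Fin (m + 1)), compMass m L S f ≤
      ENNReal.ofReal (1 + η) * compMass m L S g + ENNReal.ofReal (1 + η⁻¹) * compMass m L S h := by
    intro S
    have hQg : Measurable fun X => (‖modeProj (m + 1) L S g X‖₊ : ℝ≥0∞) ^ 2 :=
      (continuous_modeProj S hg).measurable.nnnorm.coe_nnreal_ennreal.pow_const _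
    have hQh : Measurable fun X => (‖modeProj (m + 1) L S h X‖₊ : ℝ≥0∞) ^ 2 :=
      (continuous_modeProj S hhc).measurable.nnnorm.coe_nnreal_ennreal.pow_const _
    unfold compMass
    calc ∫⁻ X in cellN (m + 1) L, (‖modeProj (m + 1) L S f X‖₊ : ℝ≥0∞) ^ 2
        ≤ ∫⁻ X in cellN (m + 1) L,
            (ENNReal.ofReal (1 + η) * (‖modeProj (m + 1) L S g X‖₊ : ℝ≥0∞) ^ 2 +
              ENNReal.ofReal (1 + η⁻¹) * (‖modeProj (m + 1) L S h X‖₊ : ℝ≥0∞) ^ 2) := by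
          refine lintegral_mono fun X => ?_
          rw [hfgh, modeProj_add S hg hhc, Pi.add_apply]
          exact Theorems.coe_nnnorm_add_sq_le _ _ hη
      _ = ENNReal.ofReal (1 + η) *
              (∫⁻ X in cellN (m + 1) L, (‖modeProj (m + 1) L S g X‖₊ : ℝ≥0∞) ^ 2) +
            ENNReal.ofReal (1 + η⁻¹) *
              (∫⁻ X in cellN (m + 1) L, (‖modeProj (m + 1) L S h X‖₊ : ℝ≥0∞) ^ 2) := by
          rw [lintegral_add_left (hQg.const_mul _), lintegral_const_mul _ hQg,
            lintegral_const_mul _ hQh]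
  -- the two total masses
  have hBg : ∑ S ∈ T, compMass m L S g ≤ 1 :=
    calc ∑ S ∈ T, compMass m L S g ≤ ∑ S, compMass m L S g :=
          Finset.sum_le_sum_of_subset_of_nonneg (Finset.subset_univ T) fun _ _ _ => zero_le
      _ ≤ 1 := by rw [sum_compMass_eq_lintegral hL hg]; exact hg1
  have hBh : ∑ S ∈ T, compMass m L S h ≤ ENNReal.ofReal (η ^ 2) :=
    calc ∑ S ∈ T, compMass m L S h ≤ ∑ S, compMass m L S h :=
          Finset.sum_le_sum_of_subset_of_nonneg (Finset.subset_univ T) fun _ _ _ => zero_le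
      _ ≤ ENNReal.ofReal (η ^ 2) := by rw [sum_compMass_eq_lintegral hL hhc]; exact hfg
  -- bookkeeping
  have hη1 : ENNReal.ofReal (1 + η) = 1 + ENNReal.ofReal η := by
    rw [ENNReal.ofReal_add zero_le_one hη.le, ENNReal.ofReal_one]
  have herr : ENNReal.ofReal η * 1 + ENNReal.ofReal (1 + η⁻¹) * ENNReal.ofReal (η ^ 2) =
      ENNReal.ofReal (2 * η + η ^ 2) := by
    rw [mul_one, ← ENNReal.ofReal_mul (by positivity), ← ENNReal.ofReal_add hη.le (by positivity)]
    congr 1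
    field_simp
    ring
  calc ∑ S ∈ T, compMass m L S f
      ≤ ∑ S ∈ T, (ENNReal.ofReal (1 + η) * compMass m L S g +
          ENNReal.ofReal (1 + η⁻¹) * compMass m L S h) := Finset.sum_le_sum fun S _ => hS S
    _ = ∑ S ∈ T, compMass m L S g + (ENNReal.ofReal η * ∑ S ∈ T, compMass m L S g +
          ENNReal.ofReal (1 + η⁻¹) * ∑ S ∈ T, compMass m L S h) := by
        rw [Finset.sum_add_distrib, ← Finset.mul_sum, ← Finset.mul_sum, hη1]
        ring
    _ ≤ ∑ S ∈ T, compMass m L S g + (ENNReal.ofReal η * 1 +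
          ENNReal.ofReal (1 + η⁻¹) * ENNReal.ofReal (η ^ 2)) := by gcongr
    _ = ∑ S ∈ T, compMass m L S g + ENNReal.ofReal (2 * η + η ^ 2) := by rw [herr]

/-! ## The registered stub -/

/-- **Registered stub `stub_countLaw`** (line `seeded-continuity` of crux `GDTransfer`, stmt-AtomisticToContinuum-9482):
the COUNT LAW — (1) for a periodic trial state the component masses `w_S = ∫|Q_S Ψ|²` sum to `1` and
`Σ_S |S| w_S = ⟨Ψ, n̂₀Ψ⟩`; (2) partial sums of the law are `L²`-Lipschitz,
`Σ_{S∈T} w_S(f) ≤ Σ_{S∈T} w_S(g) + 2η + η²` when `∫|g|² ≤ 1`, `∫|f-g|² ≤ η²`. [folklore] -/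
theorem stub_countLaw : Sig.stub_countLaw := by
  unfold Sig.stub_countLaw CountLaw
  exact ⟨fun _ _ hL Ψ => ⟨sum_compMass_trialState hL Ψ, sum_card_mul_compMass_trialState hL Ψ⟩,
    fun _ _ hL T _ _ hf hg hg1 _ hη hfg => sum_compMass_le_of_sub_le hL T hf hg hg1 hη hfg⟩

end Summit.AtomisticToContinuum.BoseEinsteinCondensation.Cruxes.GDTransfer.Seeded

end
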